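/-
Copyright (c) 2026 the pub-hodgecm-mathlib formalisation cell (harness21).  Prover seat hodgecm-mathlib-F0P3a-p01 (g38), explicit-unit SUPPORTS-ONLY on h413, req620 Track A
«(D-RAM) FOUR-FRAME» squad ((β₂) road (R-36) «PURE-CELL LEDGER», lane A (Unr-K): the CLASS LETTERS of the type-U one-field frame — which of lane B's four ray-engine letters
`hFgap ∕ hdeep ∕ hdich ∕ hwit` (★ `…RamKFrameClassLetters`, LH4-p19 (g3)) hold on type U, and which are REFUTED there), 2026-09-05.
-/
import Summits.HodgeConjecture.HodgeConjecture.Theorems.F0P3cDyRamTypeUBottomFacts   -- ★ (LH4-p11 (g5)): `forall_fixed_fixed_isNorm_of_typeU`; brings ★ p857839 `exists_aux_unit`, `exists_unit_mul_map_eq`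
import HarnessLib

/-!
# Crux `H413`, line LH4 «(D-RAM) FOUR-FRAME» — (β₂) road, (OFF) residue, lane A (type U ∕ Unr-K): «THE CLASS LETTERS OF THE TYPE-U FRAME» —
# `hFgap` HOLDS (from `hfixE`), `hdeep` HOLDS (★ `deep_of_datum` is lane-free), `hdich` and the flip witness `hwit` (= lane C's `_c20`) are FALSE on type U

Cell `hodgecm-mathlib` (D-0151), FLOOR 0, crux item H413 = `stmt-HodgeConjecture-24833`, route of record `HCCMUnconditional`; squad F0∕P3c∕LH4; lane
`--supports stmt-HodgeConjecture-24833 --as helper` (count-neutral; pays NO tier-0 row).  THEOREMS ONLY (no `def`, no instance, no notation, no `sorry`, default heartbeats);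
★-only imports; states NO census law; (β₂) stays a HYPOTHESIS.  ABSTRACT one-field frame of TYPE U (lane A): `M` complete with finite residue field, `ρ`, `Θ` commuting
isometric involutions, `|α| ≤ 1`, `|α − ρα| = 1` (`M ∕ Fix ρ` unramified) and the type-U letter `|ρα − Θα| < 1` (so `Θ` induces the NON-trivial automorphism of `𝓀[M] ∕ 𝓀[Fix ρ]`
and `M ∕ Fix Θ` is UNRAMIFIED — «Unr-K»), a uniformiser `P` (`|P| = exp(−1)`), and the transported even-order clause `hfixE` of ★ `…TypeUBottomFacts.transported_datum`.

WHY (LANE-A BOARD v4 `F0/P3a/F0P3a-p01/g38/laneA/LANE-A-BOARD.v4.F0P3ap01g38.md` §1: the open lane-A letters ‹LINE-L-A-RAY› ∕ ‹LINE-U-A-RAY›; β₂ WORD #29∕#31 «p19: RAY BANDS»).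
LH4-p19 (g3)'s ray engine pays a ray cell from FOUR class letters of the one-field frame — `hFgap` («no doubly-fixed valuation strictly between `|P|` and `1`»), `hdeep` («deep
doubly-fixed units are `Θ`-norms of `ρ`-fixed elements»), `hdich` (a `Θ`-fixed unit NON-norm `c₀` + the unit dichotomy of `M ∕ Fix Θ`) and `hwit` («some `Θ`-fixed unit `a` has
`a·ρa ∉ {eΘe : ρe = e}`») — and ★ `…RamKFrameClassLetters` discharges all four on type RamK (lane B).  THIS FILE settles the four on TYPE U (lane A), so the dealer can route
lane A's ray bands: §1 `fgap_of_fixE` — `hFgap` HOLDS (same two-line proof, from `hfixE`); `hdeep` HOLDS verbatim (★ `RamKFrameClassLetters.deep_of_datum` uses only the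
`E`-datum and `jE` — lane-free, cite it; nothing to re-prove); §2 `forall_theta_fixed_unit_isNorm_of_typeU` — on type U EVERY `Θ`-fixed unit is a norm `z·Θz` with `|z| = 1`
(Serre V §2 Prop. 3 on the UNRAMIFIED `M ∕ Fix Θ`: ★ `exists_aux_unit` gives an integer `α′` with `|Θα′ − α′| = 1`, ★ `exists_unit_mul_map_eq` lifts), whence
`not_exists_theta_fixed_unit_nonnorm_of_typeU` — the witness clause of `hdich` is FALSE on type U; §3 HEAD `forall_theta_fixed_unit_exists_fixed_norm_eq_of_typeU` — for every
`Θ`-fixed unit `a`, `a·ρa = eΘe` with `e := z·ρz` `ρ`-fixed (`a = zΘz`, `Θρ = ρΘ`), i.e. `N_{Fix Θ ∕ F}(units) ⊆ N_{Fix ρ ∕ F}(Fix ρ)`; whence `not_exists_flipWitness_of_typeU` —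
the flip witness `hwit` (lane C's block letter `_c20` `∃ a, Θa = a ∧ |a| = 1 ∧ ¬ ∃ e, ρe = e ∧ eΘe = a·ρa`, byte-identical conclusion of ★ `exists_flipWitness_of_frame`) is
FALSE on type U.  CONSEQUENCE (routing, not a theorem): the lane-A ray letters cannot be paid by instantiating the RamK engine's `hdich`∕`hwit` sockets; the flip available on
type U is the ω-FLIP UNIT `z`, `zΘz = jE ξ₀` with `ξ₀` a `σ`-fixed non-`E∕F`-norm (★ `exists_flipUnit_of_forall_fixed_fixed_isNorm` on ★ `forall_fixed_fixed_isNorm_of_typeU`,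
as in ★ p864113 `offRowALmix_of_hi`).
HONEST LABEL.  Count-neutral local algebra; nothing printed is asserted; no census law is stated; the six lane-A letters and (β₂) `stub_law_cleanSgn₂` stay HYPOTHESES ∕ UNPROVED;
`HC_CM` is proved only modulo the 7 printed citations (2 remaining named inputs: hLiu418 = `stmt-HodgeConjecture-24832`, h413 = `stmt-HodgeConjecture-24833`) until rung 0 closes.
## References
* [Serre1979] J.-P. Serre, *Local Fields*, GTM 67 (1979): Ch. V §2 Prop. 3 and Cor. (units of an unramified extension are norms), Ch. V §3 Cor. 3 (index two in the ramified case).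
* [Kottwitz1986BaseChangeUnits] R. E. Kottwitz, *Base change for unit elements of Hecke algebras*, Compositio Math. 60 (1986): §1 pp. 240–241.
* [Rogawski1990] J. D. Rogawski, *Automorphic Representations of Unitary Groups in Three Variables*, Ann. of Math. Stud. 123 (1990): §4.9 Lemma 4.9.3 p. 56.
-/

set_option autoImplicit false

noncomputable section

namespace Summit.HodgeConjecture.HodgeConjecture.Cruxes.H413.F0P3cDyRamUnrKFrameClassLetters

open scoped Valued WithZero
open WithZero
open Summit.HodgeConjecture.HodgeConjecture.Cruxes.H413.F0P3cDyRamThirdFieldPackageUnr (exists_aux_unit exists_unit_mul_map_eq)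

variable {M : Type} [Field M] [Valued M ℤᵐ⁰] {ρ Θ : M →+* M} {α : M}

/-! ## §1 `hFgap` holds on type U -/

/-- **`hFgap` FROM `hfixE`**: if every non-zero doubly-fixed `z` has valuation `exp(2n)` (the transported even-order clause of the `E`-datum, ★ `transported_datum`) and
`|P| = exp(−1)`, then no doubly-fixed element has valuation strictly between `|P|` and `1` — the RamK engine's letter `hFgap`, verbatim, on ANY one-field frame.
[cite: Serre1979, Ch. V §3 Cor. 3] -/
theorem fgap_of_fixE {P : M} (hvP : Valued.v P = exp (-1 : ℤ))
    (hfixE : ∀ z : M, ρ z = z → Θ z = z → z ≠ 0 → ∃ n : ℤ, Valued.v z = exp (2 * n)) :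
    ∀ z : M, ρ z = z → Θ z = z → Valued.v P < Valued.v z → Valued.v z ≤ 1 → Valued.v z = 1 := by
  intro z hρz hΘz hlt hle
  have hz0 : z ≠ 0 := fun h0 => by rw [h0, map_zero] at hlt; exact not_lt_of_ge zero_le hlt
  obtain ⟨n, hn⟩ := hfixE z hρz hΘz hz0
  rw [hn] at hlt hle ⊢
  rw [hvP, exp_lt_exp] at hlt
  rw [← exp_zero, exp_le_exp] at hle
  rw [← exp_zero]; congr 1; omega

/-! ## §2 On type U every `Θ`-fixed unit is a `Θ`-norm: `hdich` has no witness -/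

/-- **EVERY `Θ`-FIXED UNIT IS A NORM ON TYPE U**: `M` complete with finite residue field, `ρ`, `Θ` isometric with `Θ` an involution, `|α| ≤ 1`, `|α − ρα| = 1`, `|ρα − Θα| < 1`,
`|P| = exp(−1)`.  Then every `a` with `Θa = a`, `|a| = 1` is `z·Θz` for a unit `z` (NO `ρ`-fixedness of `a` is needed: ★ `exists_aux_unit` + ★ `exists_unit_mul_map_eq`, Serre V §2
Prop. 3 on the unramified `M ∕ Fix Θ`). [cite: Serre1979, Ch. V §2 Prop. 3 and Cor.] -/
theorem forall_theta_fixed_unit_isNorm_of_typeU [CompleteSpace M] [Finite 𝓀[M]]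
    (hvρ : ∀ x, Valued.v (ρ x) = Valued.v x) (hΘΘ : ∀ x, Θ (Θ x) = x) (hvΘ : ∀ x, Valued.v (Θ x) = Valued.v x)
    (hα1 : Valued.v α ≤ 1) (hU : Valued.v (α - ρ α) = 1) (hτ : Valued.v (ρ α - Θ α) < 1)
    {P : M} (hvP : Valued.v P = exp (-1 : ℤ)) :
    ∀ a : M, Θ a = a → Valued.v a = 1 → ∃ z : M, Valued.v z = 1 ∧ z * Θ z = a := by
  intro a hΘa ha1
  obtain ⟨α', hα'1, hm, -, hτ'⟩ := exists_aux_unit hvρ hα1 hU hτ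
  have hΘα' : Valued.v (Θ α' - α') = 1 := by
    have hτ'' : Valued.v (Θ α' - ρ α') < 1 := by rw [Valuation.map_sub_swap]; exact hτ'
    rw [show Θ α' - α' = (ρ α' - α') + (Θ α' - ρ α') by ring,
      Valuation.map_add_eq_of_lt_left _ (by rw [Valuation.map_sub_swap _ (ρ α') α', hm]; exact hτ''), Valuation.map_sub_swap _ (ρ α') α', hm]
  have ha0 : a ≠ 0 := fun h0 => by rw [h0, map_zero] at ha1; exact zero_ne_one ha1
  obtain ⟨ω, hω1, hω⟩ := exists_unit_mul_map_eq hΘΘ hvΘ hα'1 hΘα' hvP (Units.mk0 a ha0) hΘa ha1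
  exact ⟨ω, hω1, by rw [hω, Units.val_mk0]⟩

/-- **`hdich` HAS NO WITNESS ON TYPE U**: there is no `Θ`-fixed unit `c₀` which is not a norm `z·Θz` — the first two clauses of the RamK letter `hdich`
(`∃ c₀, Θc₀ = c₀ ∧ |c₀| = 1 ∧ (¬ ∃ z, zΘz = c₀) ∧ …`, ★ `RamKFrameClassLetters.dich_of_datum`) are jointly FALSE on type U. [cite: Serre1979, Ch. V §2 Prop. 3 and Cor.] -/
theorem not_exists_theta_fixed_unit_nonnorm_of_typeU [CompleteSpace M] [Finite 𝓀[M]]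
    (hvρ : ∀ x, Valued.v (ρ x) = Valued.v x) (hΘΘ : ∀ x, Θ (Θ x) = x) (hvΘ : ∀ x, Valued.v (Θ x) = Valued.v x)
    (hα1 : Valued.v α ≤ 1) (hU : Valued.v (α - ρ α) = 1) (hτ : Valued.v (ρ α - Θ α) < 1)
    {P : M} (hvP : Valued.v P = exp (-1 : ℤ)) :
    ¬ ∃ c₀ : M, Θ c₀ = c₀ ∧ Valued.v c₀ = 1 ∧ ¬ ∃ z : M, z * Θ z = c₀ := by
  rintro ⟨c₀, hΘc, hc1, hnot⟩
  obtain ⟨z, -, hz⟩ := forall_theta_fixed_unit_isNorm_of_typeU hvρ hΘΘ hvΘ hα1 hU hτ hvP c₀ hΘc hc1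
  exact hnot ⟨z, hz⟩

/-! ## §3 HEAD — on type U every `Θ`-fixed unit has its `ρ`-norm in the `E∕F`-norm class: the flip witness `hwit` is FALSE -/

/-- **HEAD — THE `ρ`-NORM OF A `Θ`-FIXED UNIT IS AN `E∕F`-NORM ON TYPE U**: same frame, with `ρ` an involution commuting with `Θ`.  For every `a` with `Θa = a`, `|a| = 1` there is a
`ρ`-fixed `e` with `eΘe = a·ρa` — namely `e := z·ρz` where `a = zΘz` (§2): `eΘe = zρz·Θz·ρΘz = (zΘz)·ρ(zΘz)`.  (Units of `Fix Θ` have norms to `F` inside `N(Fix ρ ∕ F)`.)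
[cite: Serre1979, Ch. V §2 Prop. 3 and Cor.] [cite: Kottwitz1986BaseChangeUnits, §1 pp. 240–241] -/
theorem forall_theta_fixed_unit_exists_fixed_norm_eq_of_typeU [CompleteSpace M] [Finite 𝓀[M]]
    (hρρ : ∀ x, ρ (ρ x) = x) (hvρ : ∀ x, Valued.v (ρ x) = Valued.v x) (hΘΘ : ∀ x, Θ (Θ x) = x) (hΘρ : ∀ x, Θ (ρ x) = ρ (Θ x))
    (hvΘ : ∀ x, Valued.v (Θ x) = Valued.v x)
    (hα1 : Valued.v α ≤ 1) (hU : Valued.v (α - ρ α) = 1) (hτ : Valued.v (ρ α - Θ α) < 1)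
    {P : M} (hvP : Valued.v P = exp (-1 : ℤ)) :
    ∀ a : M, Θ a = a → Valued.v a = 1 → ∃ e : M, ρ e = e ∧ e * Θ e = a * ρ a := by
  intro a hΘa ha1
  obtain ⟨z, -, hz⟩ := forall_theta_fixed_unit_isNorm_of_typeU hvρ hΘΘ hvΘ hα1 hU hτ hvP a hΘa ha1
  refine ⟨z * ρ z, by rw [map_mul, hρρ, mul_comm], ?_⟩
  rw [← hz]
  simp only [map_mul, hΘρ]
  ring

/-- **THE FLIP WITNESS `hwit` IS FALSE ON TYPE U**: the conclusion of ★ `RamKFrameClassLetters.exists_flipWitness_of_frame` (= lane C's block letter `_c20`), byte for byte,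
NEGATED: on a type-U frame there is NO `Θ`-fixed unit `a` with `a·ρa ∉ {eΘe : ρe = e}`.  So the lane-A ray letters are not instances of the RamK engine's `hwit` socket.
[cite: Serre1979, Ch. V §2 Prop. 3 and Cor.] [cite: Kottwitz1986BaseChangeUnits, §1 pp. 240–241] -/
theorem not_exists_flipWitness_of_typeU [CompleteSpace M] [Finite 𝓀[M]]
    (hρρ : ∀ x, ρ (ρ x) = x) (hvρ : ∀ x, Valued.v (ρ x) = Valued.v x) (hΘΘ : ∀ x, Θ (Θ x) = x) (hΘρ : ∀ x, Θ (ρ x) = ρ (Θ x))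
    (hvΘ : ∀ x, Valued.v (Θ x) = Valued.v x)
    (hα1 : Valued.v α ≤ 1) (hU : Valued.v (α - ρ α) = 1) (hτ : Valued.v (ρ α - Θ α) < 1)
    {P : M} (hvP : Valued.v P = exp (-1 : ℤ)) :
    ¬ ∃ a : M, Θ a = a ∧ Valued.v a = 1 ∧ ¬ ∃ e : M, ρ e = e ∧ e * Θ e = a * ρ a := by
  rintro ⟨a, hΘa, ha1, hne⟩
  exact hne (forall_theta_fixed_unit_exists_fixed_norm_eq_of_typeU hρρ hvρ hΘΘ hΘρ hvΘ hα1 hU hτ hvP a hΘa ha1)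

end Summit.HodgeConjecture.HodgeConjecture.Cruxes.H413.F0P3cDyRamUnrKFrameClassLetters

end
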